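import Summits.ResolutionOfSingularities.ResolutionOfSingularities.Theorems.CoverResolution.Negative.LoadBearing
import Literature.AlgebraicGeometry.Resolution.LogRegularSchemeEtale
import Literature.AlgebraicGeometry.Resolution.LogRegularNormal
import Mathlib.AlgebraicGeometry.Morphisms.Flat
import Mathlib.RingTheory.Flat.FaithfullyFlat.Algebra

/-!
# `CoverResolution` — negative lemmas V: `IsIntegral X` is load-bearing in the child
# `BoundaryLogRegularization`, modulo Kato 1994 (4.1)

Support (negative) lemmas for crux `stmt-ResolutionOfSingularities-15104`
(`Summit.ResolutionOfSingularities.ResolutionOfSingularities.Theses.CleanCovers.CoverResolution`),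
filed by the standing disprover (cdisprove cycle 2, line `strategy-split`; work file
`Cruxes/CoverResolution/Disproof.lean` §8). Companion of
`Negative/BoundaryLogRegularizationFalseWithoutIsFinite.lean` for the other load-bearing
hypothesis of the child P1 `BoundaryLogRegularization` (base-local proper birational LOG-REGULAR
models of a Kedlaya cover along the hyperplane at infinity):

* `isDomain_stalk_of_isLogRegularEtale` — **stalks of a log regular scheme (fs étale charts) are
  domains**, granted the named fact `Kato1994_logRegularLocal_isIntegrallyClosed` (Kato 1994
  Thm. (4.1): log regular local rings are normal domains): through a chart `U_i → Y`, `u ↦ y`, the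
  local ring `𝒪_{U_i,u}` is a domain by (4.1), and the stalk map `𝒪_{Y,y} → 𝒪_{U_i,u}` of the
  étale structure morphism is flat and local, hence faithfully flat, hence injective. (A sanity
  statement about the interface `Scheme.IsLogRegularEtale` of the children P1/P3/P2: modulo (4.1)
  it excludes every non-integral local ring, in particular the fat point.)
* `not_isDomain_stalk_spec_dualNumber` — no stalk of `Spec k[ε]` is a domain.
* `boundaryLogRegularization_false_without_isIntegral_of_kato1994` — **P1 with `IsIntegral X`
  deleted is FALSE modulo (4.1)**: witness `X = ℙ¹_{𝔽₂} ⨿ Spec 𝔽₂[ε]`, `f = 𝟙 ⨿ [1:0]` (the witness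
  of `coverResolution_false_without_isIntegral`, `Negative/LoadBearing.lean`), `h = [1:0]`; for
  every open `B ∋ h` the fat summand is an OPEN subset of `f⁻¹(B)`, so the dense open of any
  birational `π : Y → f⁻¹(B)` meets it and `Y` acquires a stalk isomorphic to a localization of
  `k[ε]` — impossible for log regular `Y`.

Moral for provers of P1 (and of the crux): reducedness of `X` over `H` is forced; irreducibility
is not (cf. `coverResolution_stripped_of_resolutionOfSingularities`). No definitions; nothing
concludes a route decl positively; the only non-Mathlib input is the named fact, taken as a
hypothesis.

## Sources
* K. Kato, *Toric singularities*, Amer. J. Math. 116 (1994), Thm. (4.1), Def. (2.1).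
* W. Nizioł, *Toric singularities: log-blow-ups and global resolutions*, J. Algebraic Geom. 15
  (2006), Def. 2.2, Lemma 2.3.
* H. Matsumura, *Commutative Ring Theory*, Thm. 7.5 (flat local ⇒ faithfully flat).
-/

noncomputable section

set_option linter.dupNamespace false -- mandated namespace of this single-conjunct summit

open CategoryTheory CategoryTheory.Limits AlgebraicGeometry
open Literature.AlgebraicGeometry.Resolution Literature.AlgebraicGeometry.Motives

namespace Summit.ResolutionOfSingularities.ResolutionOfSingularities.Theorems.CoverResolution.Negative

/-- **Stalks of a log regular scheme (fs étale charts) are domains, modulo Kato 1994 (4.1).**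
If `Y` carries a log regular atlas of fs étale charts (`Scheme.IsLogRegularEtale`) then every
local ring `𝒪_{Y,y}` is a domain, granted the named fact
`Kato1994_logRegularLocal_isIntegrallyClosed` (log regular local rings are normal domains): pick a
chart `U_i → Y` and `u ↦ y`; `𝒪_{U_i,u}` is Noetherian local (étale over locally Noetherian) and
log regular for the chart, hence a domain by (4.1); the stalk map `𝒪_{Y,y} → 𝒪_{U_i,u}` of the
étale (flat) structure map is a flat local homomorphism, hence faithfully flat, hence injective.
[cite: Kato1994, Thm. (4.1)] -/
theorem isDomain_stalk_of_isLogRegularEtale (hK : Kato1994_logRegularLocal_isIntegrallyClosed.{0})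
    {Y : Scheme.{0}} (hY : Scheme.IsLogRegularEtale Y) (y : Y) :
    IsDomain (Y.presheaf.stalk y) := by
  obtain ⟨𝒜, h𝒜⟩ := hY
  haveI := h𝒜.isLocallyNoetherian
  obtain ⟨i, u, rfl⟩ := 𝒜.exists_eq y
  haveI : IsLocallyNoetherian (𝒜.U i) := LocallyOfFiniteType.isLocallyNoetherian (𝒜.map i)
  have hdom : IsDomain ((𝒜.U i).presheaf.stalk u) :=
    (hK _ (𝒜.rk i) (𝒜.P i) (𝒜.stalkChart i u) (𝒜.fg i) (𝒜.saturated i) (𝒜.span_eq_top i)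
      (h𝒜.isLogRegularLocal i u)).1
  let φ : Y.presheaf.stalk (𝒜.map i u) →+* (𝒜.U i).presheaf.stalk u := ((𝒜.map i).stalkMap u).hom
  have hflat : φ.Flat := Flat.stalkMap (𝒜.map i) u
  letI := φ.toAlgebra
  haveI : Module.Flat (Y.presheaf.stalk (𝒜.map i u)) ((𝒜.U i).presheaf.stalk u) := hflat
  haveI : IsLocalHom (algebraMap (Y.presheaf.stalk (𝒜.map i u)) ((𝒜.U i).presheaf.stalk u)) :=
    inferInstanceAs (IsLocalHom φ)
  haveI : Module.FaithfullyFlat (Y.presheaf.stalk (𝒜.map i u)) ((𝒜.U i).presheaf.stalk u) :=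
    Module.FaithfullyFlat.of_flat_of_isLocalHom
  have hinj : Function.Injective φ :=
    FaithfulSMul.algebraMap_injective (Y.presheaf.stalk (𝒜.map i u)) ((𝒜.U i).presheaf.stalk u)
  exact Function.Injective.isDomain φ hinj


/-- **No stalk of `Spec k[ε]` is a domain**: `ε/1` is a non-zero nilpotent of every localization
of the dual numbers (an `s ∉ 𝔭` with `s·ε = 0` would lie in `𝔭`). [folklore] -/
theorem not_isDomain_stalk_spec_dualNumber (k : Type) [Field k]
    (x : ↥(Spec (CommRingCat.of (DualNumber k)))) :
    ¬ IsDomain ((Spec (CommRingCat.of (DualNumber k))).presheaf.stalk x) := by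
  intro h
  haveI : IsDomain (Localization.AtPrime x.asIdeal) :=
    Function.Injective.isDomain (Spec.stalkIso (.of (DualNumber k)) x).commRingCatIsoToRingEquiv.symm
      (Spec.stalkIso (.of (DualNumber k)) x).commRingCatIsoToRingEquiv.symm.injective
  have hε : algebraMap (DualNumber k) (Localization.AtPrime x.asIdeal) DualNumber.eps = 0 := by
    have h2 : (algebraMap (DualNumber k) (Localization.AtPrime x.asIdeal) DualNumber.eps) ^ 2 = 0 := by
      rw [← map_pow, pow_two, DualNumber.eps_mul_eps, map_zero]
    exact (pow_eq_zero_iff two_ne_zero).mp h2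
  obtain ⟨⟨s, hs⟩, hsε⟩ :=
    (IsLocalization.map_eq_zero_iff x.asIdeal.primeCompl (Localization.AtPrime x.asIdeal) _).mp hε
  exact (Ideal.mem_primeCompl_iff.mp hs) (DualNumber.mem_of_mul_eps_eq_zero x.asIdeal hsε)

/-- **`IsIntegral X` is load-bearing in `BoundaryLogRegularization` (P1), modulo Kato 1994 (4.1).**
With the integrality hypothesis deleted, the stub / child P1 of the split of `CoverResolution` is
FALSE, granted the named fact `Kato1994_logRegularLocal_isIntegrallyClosed` (log regular local
rings are domains). Witness (that of `coverResolution_false_without_isIntegral`): `p = 2`, `k = 𝔽₂`,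
`n = 1`, `X = ℙ¹_k ⨿ Spec k[ε]`, `f = 𝟙 ⨿ [1:0]` (finite, surjective, an open immersion over
`D₊(x₁)`), `h = [1:0] ∈ V₊(x₁)`. For ANY open `B ∋ h` and any proper birational `π : Y → f⁻¹(B)`:
the summand `Spec k[ε]` is OPEN in `X` and lies in `f⁻¹(B)`, so the dense open over which `π` is an
isomorphism contains one of its points `x₁`; the stalk of `Y` at the point over `x₁` is then
isomorphic to a localization of `k[ε]`, not a domain — whereas every stalk of a log regular `Y` is
a domain (`isDomain_stalk_of_isLogRegularEtale`). So any proof of P1 uses reducedness of `X` over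
`H`, exactly as for the crux. [cite: Kato1994, Thm. (4.1)] -/
theorem boundaryLogRegularization_false_without_isIntegral_of_kato1994
    (hK : Kato1994_logRegularLocal_isIntegrallyClosed.{0}) :
    ¬ (∀ p : ℕ, p.Prime → ∀ (k : Type) [Field k] [CharP k p] [PerfectField k] (n : ℕ)
        (X : AlgebraicGeometry.Scheme.{0})
        (f : X ⟶ (Literature.AlgebraicGeometry.Motives.projectiveSpace n k).left),
        AlgebraicGeometry.IsFinite f → Function.Surjective f.base →
        (letI := MvPolynomial.gradedAlgebra (σ := Fin (n + 1)) (R := k);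
          AlgebraicGeometry.Etale (f ∣_ (AlgebraicGeometry.Proj.basicOpen
            (MvPolynomial.homogeneousSubmodule (Fin (n + 1)) k) (MvPolynomial.X (Fin.last n))))) →
        ∀ h : (Literature.AlgebraicGeometry.Motives.projectiveSpace n k).left,
        (letI := MvPolynomial.gradedAlgebra (σ := Fin (n + 1)) (R := k);
          h ∉ AlgebraicGeometry.Proj.basicOpen (MvPolynomial.homogeneousSubmodule (Fin (n + 1)) k)
            (MvPolynomial.X (Fin.last n))) →
        ∃ B : (Literature.AlgebraicGeometry.Motives.projectiveSpace n k).left.Opens, h ∈ B ∧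
          ∃ (Y : AlgebraicGeometry.Scheme.{0})
            (π : Y ⟶ ((f ⁻¹ᵁ B : X.Opens) : AlgebraicGeometry.Scheme.{0})),
            AlgebraicGeometry.IsProper π ∧ Literature.AlgebraicGeometry.Resolution.IsBirational π ∧
              Literature.AlgebraicGeometry.Resolution.Scheme.IsLogRegularEtale Y) := by
  intro H
  letI := MvPolynomial.gradedAlgebra (σ := Fin (1 + 1)) (R := ZMod 2)
  let P : Scheme.{0} := (projectiveSpace 1 (ZMod 2)).left
  let T : Scheme.{0} := Spec (.of (DualNumber (ZMod 2)))
  let z : Fin (1 + 1) → ZMod 2 := Pi.single 0 1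
  have hz : z ≠ 0 := by
    intro h0; have := congrFun h0 0; simp [z] at this
  let Pv := ProjectiveSpace.pointOfVec (n := 1) (ZMod 2) z hz
  let φ : T ⟶ (specOver (ZMod 2) (ZMod 2)).left :=
    Spec.map (CommRingCat.ofHom (algebraMap (ZMod 2) (DualNumber (ZMod 2))))
  let g : T ⟶ P := φ ≫ Pv.left
  let W : P.Opens :=
    Proj.basicOpen (MvPolynomial.homogeneousSubmodule (Fin (1 + 1)) (ZMod 2)) (MvPolynomial.X (Fin.last 1))
  have hPvW : Pv.pt ∉ W := by
    show Pv.pt ∉ Proj.basicOpen _ (MvPolynomial.X (Fin.last 1))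
    rw [ProjectiveSpace.pt_pointOfVec_mem_basicOpen_X_iff z hz (Fin.last 1)]
    simp [z]
  have hgpt : ∀ t : T, g.base t = Pv.pt := by
    intro t
    show Pv.left.base (φ.base t) = Pv.left.base (IsLocalRing.closedPoint (ZMod 2))
    haveI : Subsingleton ↥(specOver (ZMod 2) (ZMod 2)).left :=
      inferInstanceAs (Subsingleton (PrimeSpectrum (ZMod 2)))
    rw [Subsingleton.elim (φ.base t) (IsLocalRing.closedPoint (ZMod 2))]
  have hg : ∀ t : T, g.base t ∉ W := fun t => by rw [hgpt t]; exact hPvW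
  let X : Scheme.{0} := P ⨿ T
  let f : X ⟶ P := coprod.desc (𝟙 P) g
  -- `f` is finite
  haveI : IsFinite φ := by
    haveI : Module.Finite (ZMod 2) (DualNumber (ZMod 2)) :=
      inferInstanceAs (Module.Finite (ZMod 2) (ZMod 2 × ZMod 2))
    show IsFinite (Spec.map _)
    rw [IsFinite.SpecMap_iff]
    exact RingHom.finite_algebraMap.mpr inferInstance
  haveI : IsClosedImmersion Pv.left := isClosedImmersion_left_of_algPoints (ZMod 2) 1 Pv
  haveI : IsFinite g := MorphismProperty.comp_mem @IsFinite φ Pv.left ‹IsFinite φ› inferInstance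
  haveI hfin : IsFinite f := inferInstance
  -- `f` is surjective (the identity summand)
  have hsurj : Function.Surjective f.base := by
    intro y
    refine ⟨(coprod.inl : P ⟶ X).base y, ?_⟩
    show ((coprod.inl : P ⟶ X) ≫ f).base y = y
    simp only [f, coprod.inl_desc]
    rfl
  -- `f` is an open immersion (hence étale) over the chart `W = D₊(x₁)`
  have hfinr : ∀ t : T, f.base ((coprod.inr : T ⟶ X).base t) = g.base t := by
    intro t
    show ((coprod.inr : T ⟶ X) ≫ f).base t = g.base t
    simp only [f, coprod.inr_desc]
  have hrange : Set.range (f ⁻¹ᵁ W).ι.base ⊆ Set.range (coprod.inl : P ⟶ X).base := by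
    rintro _ ⟨x, rfl⟩
    obtain ⟨y | t, hy⟩ := (coprodMk P T).surjective x.1
    · refine ⟨y, ?_⟩
      rw [← coprodMk_inl]
      exact hy
    · exfalso
      have hx : f.base x.1 ∈ W := x.2
      rw [← hy, coprodMk_inr] at hx
      apply hg t
      rw [← hfinr t]
      exact hx
  let l := IsOpenImmersion.lift (coprod.inl : P ⟶ X) (f ⁻¹ᵁ W).ι hrange
  have hl : l ≫ coprod.inl = (f ⁻¹ᵁ W).ι := IsOpenImmersion.lift_fac _ _ hrange
  haveI : IsOpenImmersion l := by
    haveI : IsOpenImmersion (l ≫ (coprod.inl : P ⟶ X)) := by rw [hl]; infer_instance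
    exact IsOpenImmersion.of_comp l (coprod.inl : P ⟶ X)
  have hfW : (f ∣_ W) ≫ W.ι = l := by
    rw [morphismRestrict_ι, ← hl, Category.assoc]
    simp only [f, coprod.inl_desc, Category.comp_id]
  haveI : IsOpenImmersion (f ∣_ W) := by
    haveI : IsOpenImmersion ((f ∣_ W) ≫ W.ι) := by rw [hfW]; infer_instance
    exact IsOpenImmersion.of_comp (f ∣_ W) W.ι
  have het : Etale (f ∣_ W) := inferInstance
  -- apply P1-without-integrality at `h = [1:0]`
  obtain ⟨B, hhB, Y, π, hπ, hbir, hY⟩ := H 2 Nat.prime_two (ZMod 2) 1 X f hfin hsurj het Pv.pt hPvW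
  haveI := hπ
  -- the fat summand lies in `V = f⁻¹ B` and is open there; the dense open of `π` meets it
  let V : X.Opens := f ⁻¹ᵁ B
  obtain ⟨U, hUd, -, hUiso⟩ := hbir
  haveI := hUiso
  obtain ⟨t₀⟩ : Nonempty ↥T := inferInstanceAs (Nonempty (PrimeSpectrum (DualNumber (ZMod 2))))
  have hxtB : (coprod.inr : T ⟶ X).base t₀ ∈ V := by
    show f.base ((coprod.inr : T ⟶ X).base t₀) ∈ B
    rw [hfinr t₀, hgpt t₀]
    exact hhB
  have hSopen : IsOpen (V.ι.base ⁻¹' Set.range (coprod.inr : T ⟶ X).base) :=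
    (coprod.inr : T ⟶ X).isOpenEmbedding.isOpen_range.preimage V.ι.continuous
  have hSne : (V.ι.base ⁻¹' Set.range (coprod.inr : T ⟶ X).base).Nonempty :=
    ⟨⟨_, hxtB⟩, t₀, rfl⟩
  obtain ⟨x₁, hx₁S, hx₁U⟩ := hUd.inter_open_nonempty _ hSopen hSne
  obtain ⟨t₁, ht₁⟩ := hx₁S
  -- the point `y` of `Y` over `x₁`, where `π.stalkMap` is an isomorphism
  let e := asIso (π ∣_ U)
  let zz : ↥(π ⁻¹ᵁ U) := e.inv.base ⟨x₁, hx₁U⟩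
  let y : Y := zz.1
  have hπy : π.base y = x₁ := by
    have h1 : (π ∣_ U).base zz = ⟨x₁, hx₁U⟩ := by
      show (e.inv ≫ e.hom).base ⟨x₁, hx₁U⟩ = ⟨x₁, hx₁U⟩
      rw [e.inv_hom_id]; rfl
    have h2 := morphismRestrict_base_coe π U zz
    rw [h1] at h2
    exact h2.symm
  have hisoπ : IsIso (π.stalkMap y) :=
    ((MorphismProperty.isomorphisms CommRingCat).arrow_mk_iso_iff
      (morphismRestrictStalkMap π U zz)).mp (show IsIso ((π ∣_ U).stalkMap zz) from inferInstance)
  -- stalks: `𝒪_{Y,y}` is a domain (Kato), hence so are `𝒪_{V,x₁} ≅ 𝒪_{X,inr t₁} ≅ 𝒪_{T,t₁}`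
  have hdomY : IsDomain (Y.presheaf.stalk y) := isDomain_stalk_of_isLogRegularEtale hK hY y
  have hdomV : IsDomain ((V : Scheme.{0}).presheaf.stalk x₁) := by
    have h1 : IsDomain ((V : Scheme.{0}).presheaf.stalk (π.base y)) :=
      Function.Injective.isDomain (π.stalkMap y).hom
        (asIso (π.stalkMap y)).commRingCatIsoToRingEquiv.injective
    rwa [hπy] at h1
  have hdomX : IsDomain (X.presheaf.stalk (V.ι.base x₁)) :=
    Function.Injective.isDomain (V.ι.stalkMap x₁).hom
      (asIso (V.ι.stalkMap x₁)).commRingCatIsoToRingEquiv.injective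
  rw [← ht₁] at hdomX
  have hdomT : IsDomain (T.presheaf.stalk t₁) :=
    Function.Injective.isDomain (asIso ((coprod.inr : T ⟶ X).stalkMap t₁)).commRingCatIsoToRingEquiv.symm
      (asIso ((coprod.inr : T ⟶ X).stalkMap t₁)).commRingCatIsoToRingEquiv.symm.injective
  exact not_isDomain_stalk_spec_dualNumber (ZMod 2) t₁ hdomT

end Summit.ResolutionOfSingularities.ResolutionOfSingularities.Theorems.CoverResolution.Negative

end
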